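import Literature.NumberTheory.EllipticCurves.FormalGroupNilIdealPointsGroupIso
import Literature.NumberTheory.GaloisRepresentations.LubinTateHomPoints
import Literature.NumberTheory.GaloisRepresentations.LubinTateComparisonAddPoints
import HarnessLib

/-!
# Division points of a Lubin–Tate model of `Ê` are torsion points of `E₁(K)`:
# `[n]_f = [n]_W` when `Ŵ = F_f`, `n • P(t) = P([n]_f t)`, `p`-power torsion ↔ `π`-power division points at height one,
# transport along `[1]_{f,g}` (de Shalit II.4.4 (12), II.4.9 — the local half; proofs only)

Topic `NumberTheory/EllipticCurves` (theorems only; no definition, no named fact, no instance).  Setting: a Lubin–Tate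
datum `(A, π, q)` (`LubinTate.IsLTRing`), a series `f ∈ 𝔉_π` (`IsLTSeries`) and a Weierstrass equation `V/A` WHOSE FORMAL
GROUP LAW IS `F_f` (`hV : V.formalGroupLaw = LubinTate.ltF hA hf`; supplied for an ordinary curve over `ℤ_p` by the
tree's `OrdinaryFormalGroupLubinTate.formalGroupLaw_eq_ltF_of_root`, `f = [π] = exp_W(π log_W)`, and for `X₀(49) ⊗ ℤ₂`
by `X049FormalGroupLubinTateTwo`).  For de Shalit's II.4.4 (12) / II.4.9 (ii) one evaluates Coleman series at the points
`ω_n` of a generator of the Tate module of `F_f` read as the formal parameters `t(ξ(u_n))` of `𝔭ⁿ`-TORSION POINTS of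
the curve; this file is the model-free dictionary behind that reading:

* §1 `hom_natCast_eq_formalMul_of_formalGroupLaw_eq` — **`[n]_f = [n]_W`** (`LubinTate.hom hA hf hf n = V.formalMul n`)
  for every `n : ℕ`, over ANY Lubin–Tate base (induction on `[n+1] = F([n], X)`, `hom_add`, `hom_one`, `hom_zero'`);
  so `Pt.val_nsmul_eq_ltSMul` — `n • P = [n]_f P` in `Ŵ(M)` for every nil ideal `M`.
* §2 (height one) `ltSMul_mul_eq_zero_iff_of_isUnit`, `ltSMul_pow_eq_zero_iff_of_eq_unit_mul` — if `N = ϖ·π` in `A`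
  with `ϖ` a unit (ORDINARY / height one: `p = π π̄`, `π̄ ∈ 𝒪_𝔭ˣ`), then `[Nⁿ] x = 0 ↔ [πⁿ] x = 0`.
* §3 (the curve over a complete ultrametric field `K`, `Algebra A (unitBall K)`) ★ `nsmul_ptOfZ_eq` —
  **`n • P(t) = P([n]_f t)`** in `E(K)` (tree `ptOfZ_add` / `ptHom`); `nsmul_ptOfZ_eq_zero_iff`;
  ★★ `pow_nsmul_ptOfZ_eq_zero_iff` — **`pⁿ • P(t) = O ↔ [πⁿ]_f t = 0`** when `p = ϖπ`, `ϖ ∈ Aˣ`;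
  `addOrderOf_ptOfZ_eq_prime_pow` — a PRIMITIVE `π^{n+1}`-division point gives a point of order exactly `p^{n+1}`;
  `exists_eq_ptOfZ_of_pow_nsmul_eq_zero` — conversely every `P ∈ E₁(K)` with `pⁿ • P = O` is `P(t)` with `[πⁿ]_f t = 0`
  (**`E[pⁿ] ∩ E₁(K) = P(F_f[πⁿ](𝔪_K))`**).
* §4 (a second model `g ∈ 𝔉_π`, e.g. `πX + X^q`, and the canonical isomorphism `[1]_{f,g} : F_g ≃ F_f` of
  `LubinTateHomPoints`) ★★ `pow_nsmul_ptOfZ_hom_one_eq_zero_iff` / `addOrderOf_ptOfZ_hom_one` — the image under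
  `t ↦ P([1]_{f,g} t)` of a primitive `π^{n+1}`-division point of `F_g` is a point of `E₁(K)` of order exactly `p^{n+1}`;
  `ltSMul_evalPt₁_hom_one_of_ltSMul_eq` — `[1]_{f,g}` carries a coherent sequence (`[π]_g y' = y`) to a coherent sequence;
  `evS_subst_map_hom` — **`(G ∘ [a]_{f,g})(y) = G([a]_{f,g} y)`** for `G ∈ 𝒪_K⟦X⟧` (the evaluation step «substitute
  `t = ω_n` in `Q ∘ h`» of II.4.9 (ii)).

Cell `bsd-print-cf2`, width seat `bsd-line-cf2c-w4` g14 (measure lane, CM bridge residuals (R1)/(R2) of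
`B6-BRIDGE-II-VALUES-w4g13.md` §4); no summit statement is proved; BSD is not proved by any of this.

## References
* [deShalit1987] E. de Shalit, *Iwasawa theory of elliptic curves with complex multiplication* (1987), I §1.2, II §1.10,
  II §4.4 (11)–(12) (`ω_n = t(ξ(Λ(𝔭⁻ⁿ)u_n))`, `u_n` primitive of level `𝔭ⁿ`), II §4.9 (ii).
* [LubinTate1965] J. Lubin, J. Tate, Ann. of Math. 81 (1965), §1 Thm. 1 (8)–(11) and Cor.
* [SilvermanAEC2009] J. H. Silverman, *The Arithmetic of Elliptic Curves*, 2nd ed. (2009), IV.2.3, VII.2.2.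
* [CasselsFrohlichANT1967] J.-P. Serre, *Local class field theory* (Cassels–Fröhlich Ch. VI), §3.5 Prop. 1.
-/

noncomputable section

open scoped Classical
open PowerSeries

namespace WeierstrassCurve

open Literature.NumberTheory.GaloisRepresentations.LubinTate

/-! ## §1 `[n]_f = [n]_W` when `Ŵ = F_f` -/

section Series

variable {A : Type*} [CommRing A] {π : A} {q : ℕ} (hA : IsLTRing π q) {f : PowerSeries A} (hf : IsLTSeries π q f)
  (V : WeierstrassCurve A) (hV : V.formalGroupLaw = ltF hA hf)

include hV in
/-- ★ **`[n]_f = [n]_W`**: when the formal group law of `V` IS the Lubin–Tate law `F_f`, the Lubin–Tate endomorphism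
`[n]_f` (`n ∈ ℕ ⊆ A`) is the curve's formal multiplication-by-`n` series (both satisfy `[0] = 0`, `[n+1] = F([n], X)`:
`hom_zero'`, `hom_add`, `hom_one`).  Over `ℤ_p` this is the tree's `OrdinaryFormalGroupLubinTateModule.hom_natCast_eq_formalMul`;
here over any Lubin–Tate base. [cite: LubinTate1965, §1 Thm. 1 (10)–(11)] [cite: SilvermanAEC2009, IV.2.3] -/
theorem hom_natCast_eq_formalMul_of_formalGroupLaw_eq (n : ℕ) : hom hA hf hf (n : A) = V.formalMul n := by
  induction n with
  | zero => rw [Nat.cast_zero, hom_zero' hA hf hf, formalMul_zero]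
  | succ n ih => rw [Nat.cast_succ, hom_add, ih, hom_one, ← hV, formalMul_succ]

end Series

/-! ## §1b `n • P = [n]_f P` in `Ŵ(M)` -/

section Points

variable {A : Type*} [CommRing A] [UniformSpace A] [DiscreteUniformity A]
  {S : Type*} [CommRing S] [UniformSpace S] [IsUniformAddGroup S] [IsTopologicalRing S]
  [IsLinearTopology S S] [T2Space S] [CompleteSpace S] [Algebra A S] [ContinuousSMul A S]
  (M : NilIdeal S) {π : A} {q : ℕ} (hA : IsLTRing π q) {f : PowerSeries A} (hf : IsLTSeries π q f)
  {V : WeierstrassCurve A} (hV : V.formalGroupLaw = ltF hA hf)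

include hV in
/-- **`n • P = [n]_f(P)` in `Ŵ(M)`** for every closed nil ideal `M` of a complete linearly topologised `A`-algebra
(`Pt.val_nsmul` + §1). [cite: SilvermanAEC2009, IV.2.3] [cite: LubinTate1965, §1 Thm. 1] -/
theorem Pt.val_nsmul_eq_ltSMul (n : ℕ) (P : V.Pt M) : (n • P).val = ltSMul M hA hf (n : A) P.val := by
  rw [Pt.val_nsmul]
  unfold ltSMul evalPt₁
  exact evalPt_congr M (hom_natCast_eq_formalMul_of_formalGroupLaw_eq hA hf V hV n).symm _ _ _

include hV in
/-- `n • P = 0` in `Ŵ(M)` iff `[n]_f(P) = 0`. [cite: SilvermanAEC2009, IV.2.3] -/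
theorem Pt.nsmul_eq_zero_iff_ltSMul (n : ℕ) (P : V.Pt M) : n • P = 0 ↔ ltSMul M hA hf (n : A) P.val = 0 := by
  rw [Pt.eq_zero_iff, Pt.val_nsmul_eq_ltSMul M hA hf hV]

/-! ## §2 Height one: `[ϖπ]`-division points are `[π]`-division points for a unit `ϖ` -/

/-- `[a] 0 = 0` read as: `[b] x = 0 ⟹ [ab] x = 0`. [cite: LubinTate1965, §1 Thm. 1 (9)] -/
theorem ltSMul_mul_eq_zero_of_ltSMul_eq_zero {a b : A} {x : M.toIdeal} (hx : ltSMul M hA hf b x = 0) :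
    ltSMul M hA hf (a * b) x = 0 := by
  rw [mul_ltSMul, hx, ltSMul_zero]

/-- **For a unit `a`: `[ab] x = 0 ↔ [b] x = 0`** (`[a]` is an automorphism of the points, inverse `[a⁻¹]`).
[cite: LubinTate1965, §1 Thm. 1 (9)] -/
theorem ltSMul_mul_eq_zero_iff_of_isUnit {a : A} (ha : IsUnit a) (b : A) (x : M.toIdeal) :
    ltSMul M hA hf (a * b) x = 0 ↔ ltSMul M hA hf b x = 0 := by
  refine ⟨fun h => ?_, ltSMul_mul_eq_zero_of_ltSMul_eq_zero M hA hf⟩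
  obtain ⟨u, rfl⟩ := ha
  have h' := ltSMul_mul_eq_zero_of_ltSMul_eq_zero M hA hf (a := ((u⁻¹ : Aˣ) : A)) h
  rwa [← mul_assoc, Units.inv_mul, one_mul] at h'

/-- ★ **Height one / ordinary**: if `N = ϖ·π` with `ϖ ∈ Aˣ` (e.g. `p = π̄·π` in `𝒪_𝔭 = ℤ_p` at a split prime, `π̄` a unit),
then **`[Nⁿ] x = 0 ↔ [πⁿ] x = 0`** — the `Nⁿ`-division points of `F_f` are exactly its `πⁿ`-division points.
[cite: deShalit1987, II §1.10, II §4.4] -/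
theorem ltSMul_pow_eq_zero_iff_of_eq_unit_mul {N ϖ : A} (hN : N = ϖ * π) (hϖ : IsUnit ϖ) (n : ℕ) (x : M.toIdeal) :
    ltSMul M hA hf (N ^ n) x = 0 ↔ ltSMul M hA hf (π ^ n) x = 0 := by
  rw [hN, mul_pow]
  exact ltSMul_mul_eq_zero_iff_of_isUnit M hA hf (hϖ.pow n) _ x

/-- Coherence under `[N] = [ϖ][π]`: if `[π] y' = y` then `[N] y' = [ϖ] y`. [cite: deShalit1987, II §4.4 (iv)] -/
theorem ltSMul_eq_ltSMul_of_ltSMul_eq {N ϖ : A} (hN : N = ϖ * π) {y y' : M.toIdeal} (h : ltSMul M hA hf π y' = y) :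
    ltSMul M hA hf N y' = ltSMul M hA hf ϖ y := by
  rw [hN, mul_ltSMul, h]

end Points

end WeierstrassCurve

namespace Literature.NumberTheory.EllipticCurves

open Literature.NumberTheory.GaloisRepresentations.LubinTate
open Literature.NumberTheory.EllipticCurves.FormalGroupChart _root_.WeierstrassCurve

/-! ## §3 The curve: `n • P(t) = P([n]_f t)`, `p`-power torsion of `E₁(K)` ↔ `π`-power division points -/

section Curve

variable {A : Type*} [CommRing A] [UniformSpace A] [DiscreteUniformity A]
  {K : Type*} [NontriviallyNormedField K] [IsUltrametricDist K] [CompleteSpace K]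
  [Algebra A (unitBall K)] [ContinuousSMul A (unitBall K)]
  {π : A} {q : ℕ} (hA : IsLTRing π q) {f : PowerSeries A} (hf : IsLTSeries π q f)
  {V : WeierstrassCurve A} (hV : V.formalGroupLaw = ltF hA hf) [hE : (curveOver K V).IsElliptic] [hdec : DecidableEq K]

include hV in
/-- ★ **`n • P(t) = P([n]_f t)` in `E(K)`**: the formal point of `𝔪_K` as a function of its parameter intertwines the
multiplication by `n` of the curve with the Lubin–Tate endomorphism `[n]_f` of `F_f = V̂` (`ptHom` is additive, §1b).
[cite: SilvermanAEC2009, Prop. VII.2.2, IV.2.3] [cite: deShalit1987, II §4.4 (12)] -/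
theorem nsmul_ptOfZ_eq (n : ℕ) (t : (ballNilIdeal K).toIdeal) :
    n • ptOfZ K V t = ptOfZ K V (ltSMul (ballNilIdeal K) hA hf (n : A) t) := by
  -- the group law on `E(K)` is stated for an arbitrary `DecidableEq K`; `ptHom` was built with the classical one
  obtain rfl : hdec = fun a b => Classical.propDecidable (a = b) := Subsingleton.elim _ _
  have h := (map_nsmul (ptHom K V) n (⟨t⟩ : V.Pt (ballNilIdeal K))).symm
  rw [ptHom_apply, ptHom_apply, WeierstrassCurve.Pt.val_nsmul_eq_ltSMul (ballNilIdeal K) hA hf hV] at h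
  exact h

include hV in
/-- **`n • P(t) = O ↔ [n]_f t = 0`** (`t ↦ P(t)` is injective with `P(0) = O`). [cite: SilvermanAEC2009, Prop. VII.2.2] -/
theorem nsmul_ptOfZ_eq_zero_iff (n : ℕ) (t : (ballNilIdeal K).toIdeal) :
    n • ptOfZ K V t = 0 ↔ ltSMul (ballNilIdeal K) hA hf (n : A) t = 0 := by
  rw [nsmul_ptOfZ_eq hA hf hV, ← ptOfZ_zero (K := K) (W := V)]
  exact ⟨fun h => ptOfZ_injective h, fun h => by rw [h]⟩

include hV in
/-- ★★ **`pⁿ • P(t) = O ↔ [πⁿ]_f t = 0` at height one**: for `(p : A) = ϖ·π` with `ϖ` a unit (ordinary reduction at a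
prime of degree one: `𝒪_𝔭 = ℤ_p`, `p = ψ(𝔭)ψ(𝔭̄)`, `ψ(𝔭̄) ∈ 𝒪_𝔭ˣ`), the `pⁿ`-torsion points of `E₁(K)` are the formal points
of the `πⁿ`-division points of `F_f` — de Shalit's «`E[𝔭ⁿ] = Ê[πⁿ]`» on the kernel of reduction.
[cite: deShalit1987, II §1.10, II §4.4 (12)] [cite: SilvermanAEC2009, Prop. VII.2.2] -/
theorem pow_nsmul_ptOfZ_eq_zero_iff {p : ℕ} {ϖ : A} (hp : (p : A) = ϖ * π) (hϖ : IsUnit ϖ) (n : ℕ)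
    (t : (ballNilIdeal K).toIdeal) :
    p ^ n • ptOfZ K V t = 0 ↔ ltSMul (ballNilIdeal K) hA hf (π ^ n) t = 0 := by
  rw [show p ^ n = ((p ^ n : ℕ) : ℕ) from rfl, nsmul_ptOfZ_eq_zero_iff hA hf hV, Nat.cast_pow]
  exact ltSMul_pow_eq_zero_iff_of_eq_unit_mul (ballNilIdeal K) hA hf hp hϖ n t

include hV in
/-- ★ **A primitive `π^{n+1}`-division point gives a point of ORDER EXACTLY `p^{n+1}`** (`p` prime, `p = ϖπ`, `ϖ` a unit):
`[π^{n+1}] t = 0`, `[πⁿ] t ≠ 0` ⟹ `addOrderOf P(t) = p^{n+1}` — de Shalit's `u_n` «primitive of level `𝔭ⁿ`».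
[cite: deShalit1987, II §4.4 (iv)] [cite: SilvermanAEC2009, Prop. VII.2.2] -/
theorem addOrderOf_ptOfZ_eq_prime_pow {p : ℕ} [Fact p.Prime] {ϖ : A} (hp : (p : A) = ϖ * π) (hϖ : IsUnit ϖ) {n : ℕ}
    {t : (ballNilIdeal K).toIdeal} (ht : ltSMul (ballNilIdeal K) hA hf (π ^ (n + 1)) t = 0)
    (ht' : ltSMul (ballNilIdeal K) hA hf (π ^ n) t ≠ 0) :
    addOrderOf (ptOfZ K V t) = p ^ (n + 1) :=
  addOrderOf_eq_prime_pow (fun h => ht' ((pow_nsmul_ptOfZ_eq_zero_iff hA hf hV hp hϖ n t).mp h))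
    ((pow_nsmul_ptOfZ_eq_zero_iff hA hf hV hp hϖ (n + 1) t).mpr ht)

include hV in
/-- **`E[N] ∩ E₁(K) ⊆ P(F_f[N])`**: a point of the kernel of reduction killed by `N` is `P(t)` with `[N]_f t = 0`, namely
`t = z(P)`. [cite: SilvermanAEC2009, Prop. VII.2.2] -/
theorem exists_eq_ptOfZ_of_nsmul_eq_zero {N : ℕ} {P : (curveOver K V).toAffine.Point}
    (hP : P ∈ kernel (NormedField.valuation (K := K)) (curveOver K V)) (hN : N • P = 0) :
    ∃ t : (ballNilIdeal K).toIdeal, ltSMul (ballNilIdeal K) hA hf (N : A) t = 0 ∧ P = ptOfZ K V t := by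
  refine ⟨zPt P hP, ?_, eq_ptOfZ_zPt hP⟩
  rw [← nsmul_ptOfZ_eq_zero_iff hA hf hV, ← eq_ptOfZ_zPt hP, hN]

include hV in
/-- ★ **`E[pⁿ] ∩ E₁(K) = P(F_f[πⁿ](𝔪_K))` at height one**: a point of the kernel of reduction killed by `pⁿ` is `P(t)` for a
`πⁿ`-division point `t` of `F_f` (and conversely by `pow_nsmul_ptOfZ_eq_zero_iff`). [cite: deShalit1987, II §4.4 (12)]
[cite: SilvermanAEC2009, Prop. VII.2.2] -/
theorem exists_eq_ptOfZ_of_pow_nsmul_eq_zero {p : ℕ} {ϖ : A} (hp : (p : A) = ϖ * π) (hϖ : IsUnit ϖ) {n : ℕ}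
    {P : (curveOver K V).toAffine.Point} (hP : P ∈ kernel (NormedField.valuation (K := K)) (curveOver K V))
    (hn : p ^ n • P = 0) :
    ∃ t : (ballNilIdeal K).toIdeal, ltSMul (ballNilIdeal K) hA hf (π ^ n) t = 0 ∧ P = ptOfZ K V t := by
  refine ⟨zPt P hP, ?_, eq_ptOfZ_zPt hP⟩
  rw [← pow_nsmul_ptOfZ_eq_zero_iff hA hf hV hp hϖ, ← eq_ptOfZ_zPt hP, hn]

include hV in
/-- Coherence: if `[π]_f t' = t` then **`p • P(t') = P([ϖ]_f t)`** (`[p] = [ϖ][π]`): along a generator `(t_n)` of the Tate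
module of `F_f` (`[π] t_{n+1} = t_n`) the points `P(t_n)` are `p`-coherent up to the unit `ϖ` — de Shalit II.4.4 (iv)
«`u_n ≡ u_{n−1} mod 𝔭^{n−1}L`». [cite: deShalit1987, II §4.4 (iv)] -/
theorem nsmul_ptOfZ_eq_of_ltSMul_eq {p : ℕ} {ϖ : A} (hp : (p : A) = ϖ * π) {t t' : (ballNilIdeal K).toIdeal}
    (h : ltSMul (ballNilIdeal K) hA hf π t' = t) :
    p • ptOfZ K V t' = ptOfZ K V (ltSMul (ballNilIdeal K) hA hf ϖ t) := by
  rw [nsmul_ptOfZ_eq hA hf hV]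
  exact congrArg (ptOfZ K V) (ltSMul_eq_ltSMul_of_ltSMul_eq (ballNilIdeal K) hA hf hp h)

end Curve

/-! ## §4 Transport along the canonical isomorphism `[1]_{f,g} : F_g ≃ F_f` (a second model `g`, e.g. `πX + X^q`) -/

section Transport

variable {A : Type*} [CommRing A] [UniformSpace A] [DiscreteUniformity A]
  {K : Type*} [NontriviallyNormedField K] [IsUltrametricDist K] [CompleteSpace K]
  [Algebra A (unitBall K)] [ContinuousSMul A (unitBall K)]
  {π : A} {q : ℕ} (hA : IsLTRing π q) {f g : PowerSeries A} (hf : IsLTSeries π q f) (hg : IsLTSeries π q g)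

/-- ★ **`(G ∘ [a]_{f,g})(y) = G([a]_{f,g} y)`** for `G ∈ 𝒪_K⟦X⟧` and `y ∈ 𝔪_K`: evaluating the composite of an
`𝒪_K`-series with the (coefficientwise image of the) Lubin–Tate homomorphism is evaluating `G` at the image point — the
substitution step «in the `t`-expansion … substitute `t = ω_n`» of de Shalit II.4.9 (ii) when the Coleman series is
`Q ∘ h`, `h = [1]_{f,g}` the isomorphism onto the curve's model (tree `evS_subst`, `evS_map`).
[cite: deShalit1987, II §4.9 (ii)] [cite: CasselsFrohlichANT1967, Ch. VI §3.2] -/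
theorem evS_subst_map_hom (a : A) (y : (ballNilIdeal K).toIdeal) (G : PowerSeries (unitBall K)) :
    evS (ballNilIdeal K) y (G.subst ((hom hA hf hg a).map (algebraMap A (unitBall K)))) =
      evS (ballNilIdeal K) (evalPt₁ (ballNilIdeal K) (hom hA hf hg a) (constantCoeff_hom hA hf hg a) y) G := by
  have h0 : PowerSeries.constantCoeff ((hom hA hf hg a).map (algebraMap A (unitBall K))) = 0 := by
    rw [← PowerSeries.coeff_zero_eq_constantCoeff_apply, PowerSeries.coeff_map,
      PowerSeries.coeff_zero_eq_constantCoeff_apply, constantCoeff_hom, map_zero]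
  have hpt : (⟨evS (ballNilIdeal K) y ((hom hA hf hg a).map (algebraMap A (unitBall K))),
      evS_mem_of_constantCoeff_eq_zero (ballNilIdeal K) y h0⟩ : (ballNilIdeal K).toIdeal) =
      evalPt₁ (ballNilIdeal K) (hom hA hf hg a) (constantCoeff_hom hA hf hg a) y :=
    Subtype.ext (coe_evalPt₁_eq_evS_map (ballNilIdeal K) (hom hA hf hg a) (constantCoeff_hom hA hf hg a) y).symm
  rw [evS_subst (ballNilIdeal K) y h0, hpt]

/-- **`[1]_{f,g}` carries coherent sequences to coherent sequences**: `[π]_g y' = y ⟹ [π]_f ([1] y') = [1] y`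
(`[a]_f ∘ [1]_{f,g} = [1]_{f,g} ∘ [a]_g`, tree `ltSMul_evalPt₁_hom_one`). [cite: LubinTate1965, §1 Thm. 1 (9)] -/
theorem ltSMul_evalPt₁_hom_one_of_ltSMul_eq (a : A) {y y' : (ballNilIdeal K).toIdeal}
    (h : ltSMul (ballNilIdeal K) hA hg a y' = y) :
    ltSMul (ballNilIdeal K) hA hf a (evalPt₁ (ballNilIdeal K) (hom hA hf hg 1) (constantCoeff_hom hA hf hg 1) y') =
      evalPt₁ (ballNilIdeal K) (hom hA hf hg 1) (constantCoeff_hom hA hf hg 1) y := by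
  rw [ltSMul_evalPt₁_hom_one, h]

variable {V : WeierstrassCurve A} (hV : V.formalGroupLaw = ltF hA hf) [hE : (curveOver K V).IsElliptic] [DecidableEq K]

include hV in
/-- **`n • P([1]_{f,g} y) = O ↔ [n]_g y = 0`**: through the canonical isomorphism `h = [1]_{f,g} : F_g → F_f = V̂`
(`LubinTateHomPoints`), the `n`-torsion of the formal points is read on the division points of the OTHER model `g`.
[cite: CasselsFrohlichANT1967, Ch. VI §3.5 Prop. 1] [cite: SilvermanAEC2009, Prop. VII.2.2] -/
theorem nsmul_ptOfZ_hom_one_eq_zero_iff (n : ℕ) (y : (ballNilIdeal K).toIdeal) :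
    n • ptOfZ K V (evalPt₁ (ballNilIdeal K) (hom hA hf hg 1) (constantCoeff_hom hA hf hg 1) y) = 0 ↔
      ltSMul (ballNilIdeal K) hA hg (n : A) y = 0 := by
  rw [nsmul_ptOfZ_eq_zero_iff hA hf hV, ltSMul_evalPt₁_hom_one_eq_zero_iff]

include hV in
/-- ★★ **`pⁿ • P([1]_{f,g} y) = O ↔ [πⁿ]_g y = 0`** (height one, `p = ϖπ`, `ϖ ∈ Aˣ`): the `pⁿ`-torsion points of `E₁(K)`
are the images of the `πⁿ`-division points of ANY Lubin–Tate model `g ∈ 𝔉_π` — e.g. the tree's `πX + X^q`, whose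
division points `genPt` / `cohPt` generate the tower `K_π^{n+1}`. [cite: deShalit1987, II §4.4 (12)]
[cite: CasselsFrohlichANT1967, Ch. VI §3.5 Prop. 1] -/
theorem pow_nsmul_ptOfZ_hom_one_eq_zero_iff {p : ℕ} {ϖ : A} (hp : (p : A) = ϖ * π) (hϖ : IsUnit ϖ) (n : ℕ)
    (y : (ballNilIdeal K).toIdeal) :
    p ^ n • ptOfZ K V (evalPt₁ (ballNilIdeal K) (hom hA hf hg 1) (constantCoeff_hom hA hf hg 1) y) = 0 ↔
      ltSMul (ballNilIdeal K) hA hg (π ^ n) y = 0 := by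
  rw [pow_nsmul_ptOfZ_eq_zero_iff hA hf hV hp hϖ, ltSMul_evalPt₁_hom_one_eq_zero_iff]

include hV in
/-- ★★ **A primitive `π^{n+1}`-division point `y` of `F_g` gives a point `P([1]_{f,g} y) ∈ E₁(K)` of order exactly `p^{n+1}`**
(`p` prime, `p = ϖπ`, `ϖ ∈ Aˣ`) — the torsion point `ξ(Λ(𝔭⁻ⁿ)u_n)` behind de Shalit's `ω_n` (II.4.4 (12)), for the
generator `(ω_n)` of the Tate module taken in the model `g`. [cite: deShalit1987, II §4.4 (12), (iv)]
[cite: SilvermanAEC2009, Prop. VII.2.2] -/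
theorem addOrderOf_ptOfZ_hom_one {p : ℕ} [Fact p.Prime] {ϖ : A} (hp : (p : A) = ϖ * π) (hϖ : IsUnit ϖ) {n : ℕ}
    {y : (ballNilIdeal K).toIdeal} (hy : ltSMul (ballNilIdeal K) hA hg (π ^ (n + 1)) y = 0)
    (hy' : ltSMul (ballNilIdeal K) hA hg (π ^ n) y ≠ 0) :
    addOrderOf (ptOfZ K V (evalPt₁ (ballNilIdeal K) (hom hA hf hg 1) (constantCoeff_hom hA hf hg 1) y)) = p ^ (n + 1) :=
  addOrderOf_eq_prime_pow (fun h => hy' ((pow_nsmul_ptOfZ_hom_one_eq_zero_iff hA hf hg hV hp hϖ n y).mp h))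
    ((pow_nsmul_ptOfZ_hom_one_eq_zero_iff hA hf hg hV hp hϖ (n + 1) y).mpr hy)

include hV in
/-- Coherence of the torsion points along a generator of the Tate module of `F_g`: `[π]_g y' = y` ⟹
**`p • P([1] y') = P([ϖ]_f ([1] y))`** (`p = ϖπ`). [cite: deShalit1987, II §4.4 (iv)] -/
theorem nsmul_ptOfZ_hom_one_eq_of_ltSMul_eq {p : ℕ} {ϖ : A} (hp : (p : A) = ϖ * π) {y y' : (ballNilIdeal K).toIdeal}
    (h : ltSMul (ballNilIdeal K) hA hg π y' = y) :
    p • ptOfZ K V (evalPt₁ (ballNilIdeal K) (hom hA hf hg 1) (constantCoeff_hom hA hf hg 1) y') =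
      ptOfZ K V (ltSMul (ballNilIdeal K) hA hf ϖ
        (evalPt₁ (ballNilIdeal K) (hom hA hf hg 1) (constantCoeff_hom hA hf hg 1) y)) :=
  nsmul_ptOfZ_eq_of_ltSMul_eq hA hf hV hp (ltSMul_evalPt₁_hom_one_of_ltSMul_eq hA hf hg π h)

end Transport

end Literature.NumberTheory.EllipticCurves

end
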